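import Literature.MathematicalPhysics.QuantumFieldTheory.Balaban1983to89.Beta.KKTFluctuationKernel

/-!
# Balaban β-function sub-cell, row an2 — the ENERGY IDENTITY for the fluctuation covariance kernel `Γ_N`:
# `Γ(b, b') = ⟨curv Γ_b', curv Γ_b⟩_{ℤ^{d+1}}`, hence SYMMETRY `Γ(b, b') = Γ(b', b)` and POSITIVITY `Γ(b, b) ≥ 0`
# (pub-balaban β/an2 gen 6; (D1-read) brick (Γ-sym) of AN2.md §13.3)

HONEST FRAMING (cell charter, verbatim): discharging `BetaPertH` makes Balaban's UV stability UNCONDITIONAL — a real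
constructive-QFT result; it is NOT the continuum limit and NOT the Clay problem.  This module is [folklore] lattice
calculus (Green's identities on `ℤ^{d+1}` for exponentially decaying forms) applied to the kernel `Γ_N` of
`Beta/KKTFluctuationKernel`; it cites nothing and is NOT summit progress.

WHAT IS PROVED.  §1: summability / shift toolkit on `ℤ^D` (bounded × summable is summable; `∑' (f(x+v) − f x) = 0`).
§2: GREEN'S IDENTITY FOR THE CURVATURE on the infinite lattice: for a bounded 1-form `A` and a summable 2-form `F`,
`⟨A, curvAdj F⟩ = ⟨curv A, F⟩` as absolutely convergent lattice sums (`lip1_curvAdj`; the pointwise identity is an exact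
lattice divergence, `pointwise_green`).  §3: the adjointness of `dz` / `codiff₁` in the same sense (`lip1_dz`,
`lip0_codiff₁`).  §4: BLOCK REGROUPING `∑'_x f x = ∑'_y ∑_{b ∈ box} f (N•y + b)` (`blockEquiv`, `tsum_blocks`), the
M/G COMPLEMENTARITY `∑' g·μ = 0` for `g` block-constant and `μ` with zero block sums (`tsum_mul_eq_zero_of_blockConst`) and
the adjointness of the straight-contour block sum, `⟨A, 𝒬ᵀφ⟩ = ∑'_y ∑_κ φ_κ(y) (𝒬A)_κ(y)` (`lip1_contourSumAdj`).
§5: for the kernel `Γ = KKTFluctuationKernel.Gam` (columns `Gcol l x'`, multipliers `Mcol`, `Φcol`): pairing the column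
identity (EL) `d*dΓ_b = 𝒬ᵀΦ_b + dδdM_b + δ_b` (`Gam_EL`) with another column `Γ_{b'}` and using (Q) `𝒬Γ_{b'} = 0`
(`Gam_Q`: the `𝒬ᵀΦ` term drops by §4), (G) `δdδΓ_{b'}` block-constant with (M) zero block sums of `M_b` (`Gam_G`,
`GamM_M`: the gauge term drops by §3 + §4 — this is exactly what the multiplier normalisation (M) is for) gives the
ENERGY IDENTITY `Gam l x' l' x'' = lip2 (curv Γ_{(l',x'')}) (curv Γ_{(l,x')})` (`Gam_eq_lip2`), hence
`Gam_symm : Gam l x' l' x'' = Gam l' x'' l x'` and `Gam_self_nonneg : 0 ≤ Gam l x' l x'` (`= ∑ |curv Γ_b|²`,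
`Gam_self_eq`) and, by bilinearity (`lip2_sum_left/right`, `curv_GcolSum`), POSITIVE-SEMIDEFINITENESS of every finite
quadratic form `∑_{b,b' ∈ S} a_b a_{b'} Γ(b, b') = ‖curv (∑_b a_b Γ_b)‖² ≥ 0` (`Gam_psd`).  I.e. the typed `Γ_N` is a
symmetric positive-semidefinite kernel — the covariance properties that `Beta/KKTFluctuationKernel` left open.  All sums
are justified by explicit `Summable` facts derived from `decay_Gam` / `decay_wΓμ` / `decay_wΓφ` (at fixed `N`).
No sorry, no new axioms, no cited facts.  NOT proved here (located, AN2.md §13.3): uniqueness of the decaying solution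
(tempered uniqueness per fibre is `Beta/BlochFibreUniqueness`), strict positivity on fluctuation fields, any
`N`-uniformity.

READING (markdown only, never cited; AN2.md §13.2): in print the corresponding statement is that the fluctuation
propagator is «a covariance of the Gaussian integral» ([Balaban1985BackgroundPropagators] p. 425 (3.148)), i.e. a
symmetric positive operator by construction; the typed object was constructed instead as a solution kernel (Bloch
fibres), so symmetry/positivity had to be PROVED — this file.

Version v1 (2026-08-19, b2b-balaban-beta-an2-g6).  value = kernel identity brick, NOT summit progress.
-/

namespace Literature.MathematicalPhysics.QuantumFieldTheory.Balaban1983to89.Beta.KKTFluctuationEnergy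

noncomputable section

open Literature.Probability.LatticeModels (TorusSite Torus.proj Torus.proj_apply)
open AffineAveraging (Form0 Form1 Form2 unitVec unitVec_apply dz curv curvAdj codiff₁ box toSite blockSum
  contourSum)
open AffineReproduction (contourSumAdj IsBlockConst)
open LatticeForm (repZ quo proj_repZ proj_add_zsmul)
open BlochFibreUniqueness (quo_add_zsmul quo_repZ)
open BlochFibreMatrix (eq_repZ_add_zsmul_quo toSite_eq_repZ_proj)
open KKTFluctuationKernel (wΓμ wΓφ Gam GamΦ GamM Gam_EL Gam_G GamM_M Gam_Q decay_Gam decay_wΓμ decay_wΓφ)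
open DecimatedMomentLimit (summable_of_decay510)
open B12Sec2to5 (l1 l1_nonneg Decay510 summable_exp_neg_l1)

variable {D N : ℕ}

/-! ## §1 Toolkit: lattice pairings, shifts, bounded × summable -/

section Toolkit

/-- The lattice pairing of 0-forms `∑'_x f x · g x`. [folklore] -/
def lip0 (f g : Form0 D ℝ) : ℝ := ∑' x, f x * g x

/-- The lattice pairing of 1-forms `∑'_x ∑_μ A_μ(x) B_μ(x)`. [folklore] -/
def lip1 (A B : Form1 D ℝ) : ℝ := ∑' x, ∑ μ, A μ x * B μ x

/-- The lattice pairing of 2-forms `∑'_x ∑_{κ,l} F_{κl}(x) G_{κl}(x)` (ordered pairs, as everywhere in the cell). [folklore] -/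
def lip2 (F G : Form2 D ℝ) : ℝ := ∑' x, ∑ κ, ∑ l, F κ l x * G κ l x

/-- `lip2` is symmetric. [folklore] -/
theorem lip2_comm (F G : Form2 D ℝ) : lip2 F G = lip2 G F :=
  tsum_congr fun _ => Finset.sum_congr rfl fun _ _ => Finset.sum_congr rfl fun _ _ => mul_comm _ _

/-- Shifts preserve summability. [folklore] -/
theorem summable_shift {f : AffineAveraging.Site D → ℝ} (hf : Summable f) (v : AffineAveraging.Site D) :
    Summable (fun x => f (x + v)) := by
  exact (Equiv.addRight v).summable_iff.mpr hf

/-- Shifts preserve summability (subtractive form). [folklore] -/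
theorem summable_shift_sub {f : AffineAveraging.Site D → ℝ} (hf : Summable f) (v : AffineAveraging.Site D) :
    Summable (fun x => f (x - v)) := by
  exact (Equiv.subRight v).summable_iff.mpr hf

/-- Shift invariance of the lattice sum. [folklore] -/
theorem tsum_shift (f : AffineAveraging.Site D → ℝ) (v : AffineAveraging.Site D) : ∑' x, f (x + v) = ∑' x, f x := by
  exact (Equiv.addRight v).tsum_eq f

/-- Shift invariance of the lattice sum (subtractive form). [folklore] -/
theorem tsum_shift_sub (f : AffineAveraging.Site D → ℝ) (v : AffineAveraging.Site D) :
    ∑' x, f (x - v) = ∑' x, f x := by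
  exact (Equiv.subRight v).tsum_eq f

/-- A lattice DIVERGENCE sums to zero: `∑'_x (f (x + v) − f x) = 0` for summable `f`. [folklore] -/
theorem tsum_shift_sub_self {f : AffineAveraging.Site D → ℝ} (hf : Summable f) (v : AffineAveraging.Site D) :
    ∑' x, (f (x + v) - f x) = 0 := by
  rw [(summable_shift hf v).tsum_sub hf, tsum_shift, sub_self]

/-- … and `∑'_x (f x − f (x + v)) = 0`. [folklore] -/
theorem tsum_self_sub_shift {f : AffineAveraging.Site D → ℝ} (hf : Summable f) (v : AffineAveraging.Site D) :
    ∑' x, (f x - f (x + v)) = 0 := by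
  rw [hf.tsum_sub (summable_shift hf v), tsum_shift, sub_self]

/-- Bounded × summable is summable. [folklore] -/
theorem summable_mul_of_bdd {f g : AffineAveraging.Site D → ℝ} {M : ℝ} (hf : ∀ x, |f x| ≤ M) (hg : Summable g) :
    Summable (fun x => f x * g x) := by
  refine Summable.of_norm_bounded (hg.abs.mul_left M) (fun x => ?_)
  rw [Real.norm_eq_abs, abs_mul]
  exact mul_le_mul_of_nonneg_right (hf x) (abs_nonneg _)

/-- Summable × bounded is summable. [folklore] -/
theorem summable_mul_of_bdd' {f g : AffineAveraging.Site D → ℝ} {M : ℝ} (hf : Summable f) (hg : ∀ x, |g x| ≤ M) :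
    Summable (fun x => f x * g x) := by
  have h := summable_mul_of_bdd hg hf
  simpa only [mul_comm] using h

/-- A function with an exponential bound about a centre is summable. [folklore] -/
theorem summable_of_exp_bound {f : AffineAveraging.Site D → ℝ} {C δ : ℝ} (hδ : 0 < δ) (c : AffineAveraging.Site D)
    (h : ∀ x, |f x| ≤ C * Real.exp (-δ * l1 (x - c))) : Summable f := by
  refine Summable.of_norm_bounded ((summable_shift_sub (summable_exp_neg_l1 hδ D) c).mul_left C) (fun x => ?_)
  rw [Real.norm_eq_abs]
  exact h x

/-- … and bounded by the constant. [folklore] -/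
theorem abs_le_of_exp_bound {f : AffineAveraging.Site D → ℝ} {C δ : ℝ} (hδ : 0 < δ) (hC : 0 ≤ C)
    (c : AffineAveraging.Site D) (h : ∀ x, |f x| ≤ C * Real.exp (-δ * l1 (x - c))) (x : AffineAveraging.Site D) :
    |f x| ≤ C := by
  refine (h x).trans ?_
  have he : Real.exp (-δ * l1 (x - c)) ≤ 1 := by
    rw [Real.exp_le_one_iff]
    nlinarith [l1_nonneg (x - c)]
  nlinarith

/-- `|dz g| ≤ 2M` for `|g| ≤ M`. [folklore] -/
theorem abs_dz_le {g : Form0 D ℝ} {M : ℝ} (hg : ∀ x, |g x| ≤ M) (κ : Fin D) (x : AffineAveraging.Site D) :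
    |dz g κ x| ≤ 2 * M := by
  simp only [dz]
  have h := abs_sub (g (x + unitVec κ)) (g x)
  linarith [hg (x + unitVec κ), hg x]

/-- `|codiff₁ A| ≤ 2DM` for `|A| ≤ M`. [folklore] -/
theorem abs_codiff₁_le {A : Form1 D ℝ} {M : ℝ} (hA : ∀ κ x, |A κ x| ≤ M) (x : AffineAveraging.Site D) :
    |codiff₁ A x| ≤ D * (2 * M) := by
  simp only [codiff₁]
  calc |∑ κ, (A κ (x - unitVec κ) - A κ x)| ≤ ∑ κ : Fin D, |A κ (x - unitVec κ) - A κ x| :=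
        Finset.abs_sum_le_sum_abs _ _
    _ ≤ ∑ _κ : Fin D, 2 * M := Finset.sum_le_sum fun κ _ => by
        have h := abs_sub (A κ (x - unitVec κ)) (A κ x)
        linarith [hA κ (x - unitVec κ), hA κ x]
    _ = D * (2 * M) := by simp

/-- `|curv A| ≤ 4M` for `|A| ≤ M`. [folklore] -/
theorem abs_curv_le {A : Form1 D ℝ} {M : ℝ} (hA : ∀ κ x, |A κ x| ≤ M) (κ l : Fin D) (x : AffineAveraging.Site D) :
    |curv A κ l x| ≤ 4 * M := by
  simp only [curv]
  have h1 := hA κ x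
  have h2 := hA l (x + unitVec κ)
  have h3 := hA κ (x + unitVec l)
  have h4 := hA l x
  have e1 := abs_sub (A κ x + A l (x + unitVec κ) - A κ (x + unitVec l)) (A l x)
  have e2 := abs_sub (A κ x + A l (x + unitVec κ)) (A κ (x + unitVec l))
  have e3 := abs_add_le (A κ x) (A l (x + unitVec κ))
  linarith

/-- `|𝒬ᵀφ| ≤ N·M` for `|φ| ≤ M`. [folklore] -/
theorem abs_contourSumAdj_le {φ : Form1 D ℝ} {M : ℝ} (hφ : ∀ κ y, |φ κ y| ≤ M) (κ : Fin D)
    (x : AffineAveraging.Site D) : |contourSumAdj N φ κ x| ≤ N * M := by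
  simp only [contourSumAdj]
  calc |∑ s ∈ Finset.range N, φ κ (fun i => (x - (s : ℤ) • unitVec κ) i / (N : ℤ))|
      ≤ ∑ s ∈ Finset.range N, |φ κ (fun i => (x - (s : ℤ) • unitVec κ) i / (N : ℤ))| :=
        Finset.abs_sum_le_sum_abs _ _
    _ ≤ ∑ _s ∈ Finset.range N, M := Finset.sum_le_sum fun s _ => hφ κ _
    _ = N * M := by simp

/-- `dz` of a summable 0-form is summable. [folklore] -/
theorem summable_dz {g : Form0 D ℝ} (hg : Summable g) (κ : Fin D) : Summable (dz g κ) := by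
  have h := (summable_shift hg (unitVec κ)).sub hg
  exact h

/-- `codiff₁` of a summable 1-form is summable. [folklore] -/
theorem summable_codiff₁ {A : Form1 D ℝ} (hA : ∀ κ, Summable (A κ)) : Summable (codiff₁ A) := by
  have h : Summable (fun x => ∑ κ, (A κ (x - unitVec κ) - A κ x)) :=
    summable_sum fun κ _ => (summable_shift_sub (hA κ) (unitVec κ)).sub (hA κ)
  exact h

/-- `curv` of a summable 1-form is summable. [folklore] -/
theorem summable_curv {A : Form1 D ℝ} (hA : ∀ κ, Summable (A κ)) (κ l : Fin D) : Summable (curv A κ l) := by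
  have h : Summable (fun x => A κ x + A l (x + unitVec κ) - A κ (x + unitVec l) - A l x) :=
    (((hA κ).add (summable_shift (hA l) (unitVec κ))).sub (summable_shift (hA κ) (unitVec l))).sub (hA l)
  exact h

/-- Additivity of `lip1` in the second slot, under summability of both pairings. [folklore] -/
theorem lip1_add {A B C : Form1 D ℝ} (hB : ∀ μ, Summable (fun x => A μ x * B μ x))
    (hC : ∀ μ, Summable (fun x => A μ x * C μ x)) : lip1 A (B + C) = lip1 A B + lip1 A C := by
  unfold lip1
  simp only [Pi.add_apply, mul_add, Finset.sum_add_distrib]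
  exact (summable_sum fun μ _ => hB μ).tsum_add (summable_sum fun μ _ => hC μ)

/-- `lip2` of a finite linear combination in the first slot, under summability of each pairing. [folklore] -/
theorem lip2_sum_left {ι : Type*} (S : Finset ι) (c : ι → ℝ) (F : ι → Form2 D ℝ) (G : Form2 D ℝ)
    (h : ∀ i ∈ S, ∀ κ l, Summable (fun x => F i κ l x * G κ l x)) :
    lip2 (fun κ l x => ∑ i ∈ S, c i * F i κ l x) G = ∑ i ∈ S, c i * lip2 (F i) G := by
  unfold lip2
  have e : ∀ x : AffineAveraging.Site D, ∑ κ, ∑ l, (∑ i ∈ S, c i * F i κ l x) * G κ l x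
      = ∑ i ∈ S, c i * ∑ κ, ∑ l, F i κ l x * G κ l x := by
    intro x
    simp only [Finset.sum_mul, mul_assoc, Finset.mul_sum]
    calc ∑ κ, ∑ l, ∑ i ∈ S, c i * (F i κ l x * G κ l x)
        = ∑ κ, ∑ i ∈ S, ∑ l, c i * (F i κ l x * G κ l x) := Finset.sum_congr rfl fun κ _ => Finset.sum_comm
      _ = ∑ i ∈ S, ∑ κ, ∑ l, c i * (F i κ l x * G κ l x) := Finset.sum_comm
  refine (tsum_congr e).trans ?_
  rw [Summable.tsum_finsetSum (fun i hi =>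
    (summable_sum fun κ _ => summable_sum fun l _ => h i hi κ l).mul_left (c i))]
  exact Finset.sum_congr rfl fun i _ => tsum_mul_left

/-- `lip2` of a finite linear combination in the second slot. [folklore] -/
theorem lip2_sum_right {ι : Type*} (S : Finset ι) (c : ι → ℝ) (F : ι → Form2 D ℝ) (G : Form2 D ℝ)
    (h : ∀ i ∈ S, ∀ κ l, Summable (fun x => G κ l x * F i κ l x)) :
    lip2 G (fun κ l x => ∑ i ∈ S, c i * F i κ l x) = ∑ i ∈ S, c i * lip2 G (F i) := by
  rw [lip2_comm, lip2_sum_left S c F G (fun i hi κ l => by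
    have h' := h i hi κ l
    simpa only [mul_comm] using h')]
  exact Finset.sum_congr rfl fun i _ => by rw [lip2_comm]

end Toolkit

/-! ## §2 Green's identity for the curvature on `ℤ^D` -/

section Green

/-- Auxiliary product `A_a(x) F_{ab}(x − e_b)`. [folklore] -/
def gu (A : Form1 D ℝ) (F : Form2 D ℝ) (a b : Fin D) (x : AffineAveraging.Site D) : ℝ := A a x * F a b (x - unitVec b)

/-- Auxiliary product `A_b(x) F_{ab}(x − e_a)`. [folklore] -/
def gv (A : Form1 D ℝ) (F : Form2 D ℝ) (a b : Fin D) (x : AffineAveraging.Site D) : ℝ := A b x * F a b (x - unitVec a)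

/-- THE POINTWISE IDENTITY: `∑_μ A_μ (curvAdj F)_μ − ∑_{κl} (curv A)_{κl} F_{κl}` is an exact lattice divergence. [folklore] -/
theorem pointwise_green (A : Form1 D ℝ) (F : Form2 D ℝ) (x : AffineAveraging.Site D) :
    ∑ μ, A μ x * curvAdj F μ x
      = (∑ κ, ∑ l, curv A κ l x * F κ l x)
        + ∑ a, ∑ b, (gu A F a b (x + unitVec b) - gu A F a b x)
        + ∑ a, ∑ b, (gv A F a b x - gv A F a b (x + unitVec a)) := by
  have eL : ∑ μ, A μ x * curvAdj F μ x
      = ∑ a, ∑ b, ((A a x * F a b x - A a x * F a b (x - unitVec b))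
          + (A b x * F a b (x - unitVec a) - A b x * F a b x)) := by
    simp only [curvAdj, mul_add, Finset.mul_sum, mul_sub, Finset.sum_add_distrib]
    congr 1
    exact Finset.sum_comm
  have eR : (∑ κ, ∑ l, curv A κ l x * F κ l x)
        + ∑ a, ∑ b, (gu A F a b (x + unitVec b) - gu A F a b x)
        + ∑ a, ∑ b, (gv A F a b x - gv A F a b (x + unitVec a))
      = ∑ a, ∑ b, ((A a x + A b (x + unitVec a) - A a (x + unitVec b) - A b x) * F a b x
          + (A a (x + unitVec b) * F a b x - A a x * F a b (x - unitVec b))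
          + (A b x * F a b (x - unitVec a) - A b (x + unitVec a) * F a b x)) := by
    simp only [curv, gu, gv, add_sub_cancel_right, Finset.sum_add_distrib]
  rw [eL, eR]
  refine Finset.sum_congr rfl (fun a _ => Finset.sum_congr rfl (fun b _ => ?_))
  ring

/-- **GREEN'S IDENTITY FOR THE CURVATURE ON THE INFINITE LATTICE.**  For a bounded 1-form `A` and a summable 2-form `F`:
`⟨A, curvAdj F⟩ = ⟨curv A, F⟩` as absolutely convergent sums over `ℤ^D`. [folklore] -/
theorem lip1_curvAdj {A : Form1 D ℝ} {F : Form2 D ℝ} {M : ℝ} (hA : ∀ μ x, |A μ x| ≤ M)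
    (hF : ∀ κ l, Summable (F κ l)) : lip1 A (curvAdj F) = lip2 (curv A) F := by
  have hu : ∀ a b, Summable (gu A F a b) := fun a b =>
    summable_mul_of_bdd (hA a) (summable_shift_sub (hF a b) (unitVec b))
  have hv : ∀ a b, Summable (gv A F a b) := fun a b =>
    summable_mul_of_bdd (hA b) (summable_shift_sub (hF a b) (unitVec a))
  have hC : Summable (fun x => ∑ κ, ∑ l, curv A κ l x * F κ l x) :=
    summable_sum fun κ _ => summable_sum fun l _ => summable_mul_of_bdd (abs_curv_le hA κ l) (hF κ l)
  have hD1 : Summable (fun x => ∑ a, ∑ b, (gu A F a b (x + unitVec b) - gu A F a b x)) :=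
    summable_sum fun a _ => summable_sum fun b _ => (summable_shift (hu a b) _).sub (hu a b)
  have hD2 : Summable (fun x => ∑ a, ∑ b, (gv A F a b x - gv A F a b (x + unitVec a))) :=
    summable_sum fun a _ => summable_sum fun b _ => (hv a b).sub (summable_shift (hv a b) _)
  have z1 : ∑' x, ∑ a, ∑ b, (gu A F a b (x + unitVec b) - gu A F a b x) = 0 := by
    rw [Summable.tsum_finsetSum (fun a _ => summable_sum fun b _ => (summable_shift (hu a b) _).sub (hu a b))]
    refine Finset.sum_eq_zero (fun a _ => ?_)
    rw [Summable.tsum_finsetSum (fun b _ => (summable_shift (hu a b) _).sub (hu a b))]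
    exact Finset.sum_eq_zero (fun b _ => tsum_shift_sub_self (hu a b) _)
  have z2 : ∑' x, ∑ a, ∑ b, (gv A F a b x - gv A F a b (x + unitVec a)) = 0 := by
    rw [Summable.tsum_finsetSum (fun a _ => summable_sum fun b _ => (hv a b).sub (summable_shift (hv a b) _))]
    refine Finset.sum_eq_zero (fun a _ => ?_)
    rw [Summable.tsum_finsetSum (fun b _ => (hv a b).sub (summable_shift (hv a b) _))]
    exact Finset.sum_eq_zero (fun b _ => tsum_self_sub_shift (hv a b) _)
  unfold lip1 lip2
  rw [show (fun x => ∑ μ, A μ x * curvAdj F μ x)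
      = fun x => (∑ κ, ∑ l, curv A κ l x * F κ l x)
        + ∑ a, ∑ b, (gu A F a b (x + unitVec b) - gu A F a b x)
        + ∑ a, ∑ b, (gv A F a b x - gv A F a b (x + unitVec a)) from funext (pointwise_green A F)]
  rw [(hC.add hD1).tsum_add hD2, hC.tsum_add hD1, z1, z2, add_zero, add_zero]

end Green

/-! ## §3 Adjointness of `dz` and `codiff₁` on `ℤ^D` -/

section Adjoint

/-- `⟨A, dz g⟩ = ⟨codiff₁ A, g⟩` for bounded `A` and summable `g`. [folklore] -/
theorem lip1_dz {A : Form1 D ℝ} {g : Form0 D ℝ} {M : ℝ} (hA : ∀ μ x, |A μ x| ≤ M) (hg : Summable g) :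
    lip1 A (dz g) = lip0 (codiff₁ A) g := by
  have hp : ∀ μ, Summable (fun x => A μ x * g (x + unitVec μ)) := fun μ =>
    summable_mul_of_bdd (hA μ) (summable_shift hg _)
  have hq : ∀ μ, Summable (fun x => A μ x * g x) := fun μ => summable_mul_of_bdd (hA μ) hg
  have hp' : ∀ μ, Summable (fun x => A μ (x - unitVec μ) * g x) := fun μ => by
    have h := summable_shift_sub (hp μ) (unitVec μ)
    simpa only [sub_add_cancel] using h
  unfold lip1 lip0
  calc ∑' x, ∑ μ, A μ x * dz g μ x = ∑' x, ∑ μ, (A μ x * g (x + unitVec μ) - A μ x * g x) := by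
        refine tsum_congr (fun x => Finset.sum_congr rfl (fun μ _ => ?_))
        simp only [dz, mul_sub]
    _ = ∑ μ, ∑' x, (A μ x * g (x + unitVec μ) - A μ x * g x) :=
        Summable.tsum_finsetSum (fun μ _ => (hp μ).sub (hq μ))
    _ = ∑ μ, ∑' x, (A μ (x - unitVec μ) * g x - A μ x * g x) := by
        refine Finset.sum_congr rfl (fun μ _ => ?_)
        rw [(hp μ).tsum_sub (hq μ), (hp' μ).tsum_sub (hq μ)]
        congr 1
        rw [← tsum_shift_sub (fun x => A μ x * g (x + unitVec μ)) (unitVec μ)]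
        simp only [sub_add_cancel]
    _ = ∑' x, ∑ μ, (A μ (x - unitVec μ) * g x - A μ x * g x) :=
        (Summable.tsum_finsetSum (fun μ _ => (hp' μ).sub (hq μ))).symm
    _ = ∑' x, codiff₁ A x * g x := by
        refine tsum_congr (fun x => ?_)
        simp only [codiff₁, Finset.sum_mul, sub_mul]

/-- `⟨f, codiff₁ B⟩ = ⟨dz f, B⟩` for bounded `f` and summable `B`. [folklore] -/
theorem lip0_codiff₁ {f : Form0 D ℝ} {B : Form1 D ℝ} {M : ℝ} (hf : ∀ x, |f x| ≤ M) (hB : ∀ κ, Summable (B κ)) :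
    lip0 f (codiff₁ B) = lip1 (dz f) B := by
  have hr : ∀ κ, Summable (fun x => f x * B κ (x - unitVec κ)) := fun κ =>
    summable_mul_of_bdd hf (summable_shift_sub (hB κ) _)
  have hs : ∀ κ, Summable (fun x => f x * B κ x) := fun κ => summable_mul_of_bdd hf (hB κ)
  have hr' : ∀ κ, Summable (fun x => f (x + unitVec κ) * B κ x) := fun κ => by
    have h := summable_shift (hr κ) (unitVec κ)
    simpa only [add_sub_cancel_right] using h
  unfold lip0 lip1
  calc ∑' x, f x * codiff₁ B x = ∑' x, ∑ κ, (f x * B κ (x - unitVec κ) - f x * B κ x) := by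
        refine tsum_congr (fun x => ?_)
        simp only [codiff₁, Finset.mul_sum, mul_sub]
    _ = ∑ κ, ∑' x, (f x * B κ (x - unitVec κ) - f x * B κ x) :=
        Summable.tsum_finsetSum (fun κ _ => (hr κ).sub (hs κ))
    _ = ∑ κ, ∑' x, (f (x + unitVec κ) * B κ x - f x * B κ x) := by
        refine Finset.sum_congr rfl (fun κ _ => ?_)
        rw [(hr κ).tsum_sub (hs κ), (hr' κ).tsum_sub (hs κ)]
        congr 1
        rw [← tsum_shift (fun x => f x * B κ (x - unitVec κ)) (unitVec κ)]
        simp only [add_sub_cancel_right]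
    _ = ∑' x, ∑ κ, (f (x + unitVec κ) * B κ x - f x * B κ x) :=
        (Summable.tsum_finsetSum (fun κ _ => (hr' κ).sub (hs κ))).symm
    _ = ∑' x, ∑ κ, dz f κ x * B κ x := by
        refine tsum_congr (fun x => Finset.sum_congr rfl (fun κ _ => ?_))
        simp only [dz, sub_mul]

end Adjoint

/-! ## §4 Block regrouping, the M/G complementarity, adjointness of the contour block sum -/

section Blocks

variable [NeZero N]

/-- `ℤ^D ≃ ℤ^D × (ℤ/N)^D`: a site is its block index and its box representative. [folklore] -/
def blockEquiv (D N : ℕ) [NeZero N] : AffineAveraging.Site D × TorusSite D N ≃ AffineAveraging.Site D where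
  toFun p := repZ p.2 + (N : ℤ) • p.1
  invFun x := (quo N x, Torus.proj N x)
  left_inv p := by
    rcases p with ⟨y, z⟩
    show (quo N (repZ z + (N : ℤ) • y), Torus.proj N (repZ z + (N : ℤ) • y)) = (y, z)
    rw [quo_add_zsmul, quo_repZ, zero_add, proj_add_zsmul, proj_repZ]
  right_inv x := (eq_repZ_add_zsmul_quo (N := N) x).symm

/-- A box-indexed sum is a torus-indexed sum over representatives. [folklore] -/
theorem sum_torus_eq_sum_box (g : AffineAveraging.Site D → ℝ) :
    ∑ z : TorusSite D N, g (repZ z) = ∑ b ∈ box D N, g (toSite b) := by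
  symm
  refine Finset.sum_nbij' (fun b => Torus.proj N (toSite b)) (fun z j => (z j).val) ?_ ?_ ?_ ?_ ?_
  · intro b _; exact Finset.mem_univ _
  · intro z _
    simp only [AffineAveraging.box, Fintype.mem_piFinset, Finset.mem_range]
    exact fun j => ZMod.val_lt (z j)
  · intro b hb
    simp only [AffineAveraging.box, Fintype.mem_piFinset, Finset.mem_range] at hb
    funext j
    simp only [Torus.proj_apply, toSite, Int.cast_natCast, ZMod.val_natCast]
    exact Nat.mod_eq_of_lt (hb j)
  · intro z _
    funext j
    simp only [Torus.proj_apply, toSite, Int.cast_natCast, ZMod.natCast_zmod_val]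
  · intro b hb
    rw [← toSite_eq_repZ_proj hb]

/-- **BLOCK REGROUPING** of an absolutely convergent lattice sum: `∑'_x f x = ∑'_y ∑_{b ∈ box} f (N•y + b)`. [folklore] -/
theorem tsum_blocks {f : AffineAveraging.Site D → ℝ} (hf : Summable f) :
    ∑' x, f x = ∑' y, ∑ b ∈ box D N, f ((N : ℤ) • y + toSite b) := by
  have hf' : Summable (f ∘ ⇑(blockEquiv D N)) := (blockEquiv D N).summable_iff.mpr hf
  rw [← (blockEquiv D N).tsum_eq f]
  rw [show (∑' p, f ((blockEquiv D N) p)) = ∑' p, (f ∘ ⇑(blockEquiv D N)) p from rfl,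
    hf'.tsum_prod' (fun y => hf'.prod_factor y)]
  refine tsum_congr (fun y => ?_)
  rw [tsum_fintype]
  calc ∑ z : TorusSite D N, (f ∘ ⇑(blockEquiv D N)) (y, z) = ∑ b ∈ box D N, f (toSite b + (N : ℤ) • y) :=
        sum_torus_eq_sum_box (N := N) (fun r => f (r + (N : ℤ) • y))
    _ = ∑ b ∈ box D N, f ((N : ℤ) • y + toSite b) := Finset.sum_congr rfl fun b _ => by rw [add_comm]

/-- … and the block sums form a summable coarse family. [folklore] -/
theorem summable_blocks {f : AffineAveraging.Site D → ℝ} (hf : Summable f) :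
    Summable (fun y => ∑ b ∈ box D N, f ((N : ℤ) • y + toSite b)) := by
  have hf' : Summable (f ∘ ⇑(blockEquiv D N)) := (blockEquiv D N).summable_iff.mpr hf
  have h := hf'.hasSum.prod_fiberwise (fun y => (hf'.prod_factor y).hasSum)
  refine h.summable.congr (fun y => ?_)
  rw [tsum_fintype]
  calc ∑ z : TorusSite D N, (f ∘ ⇑(blockEquiv D N)) (y, z) = ∑ b ∈ box D N, f (toSite b + (N : ℤ) • y) :=
        sum_torus_eq_sum_box (N := N) (fun r => f (r + (N : ℤ) • y))
    _ = ∑ b ∈ box D N, f ((N : ℤ) • y + toSite b) := Finset.sum_congr rfl fun b _ => by rw [add_comm]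

/-- **M/G COMPLEMENTARITY.**  A bounded BLOCK-CONSTANT function is orthogonal to every summable function with ZERO BLOCK
SUMS: `∑'_x g x · μ x = 0`. [folklore] -/
theorem tsum_mul_eq_zero_of_blockConst {g μ : Form0 D ℝ} {M : ℝ} (hg : ∀ x, |g x| ≤ M) (hgc : IsBlockConst N g)
    (hμ : Summable μ) (hμ0 : ∀ y, blockSum N μ y = 0) : ∑' x, g x * μ x = 0 := by
  rw [tsum_blocks (N := N) (summable_mul_of_bdd hg hμ)]
  refine (tsum_congr (fun y => ?_)).trans tsum_zero
  calc ∑ b ∈ box D N, g ((N : ℤ) • y + toSite b) * μ ((N : ℤ) • y + toSite b)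
      = ∑ b ∈ box D N, g ((N : ℤ) • y) * μ ((N : ℤ) • y + toSite b) :=
        Finset.sum_congr rfl fun b hb => by rw [hgc y b hb]
    _ = g ((N : ℤ) • y) * blockSum N μ y := by rw [blockSum, Finset.mul_sum]
    _ = 0 := by rw [hμ0 y, mul_zero]

omit [NeZero N] in
/-- The block index of a box point. [folklore] -/
theorem quo_zsmul_add_toSite [NeZero N] (y : AffineAveraging.Site D) {b : Fin D → ℕ} (hb : b ∈ box D N) :
    quo N ((N : ℤ) • y + toSite b) = y := by
  rw [add_comm, quo_add_zsmul, toSite_eq_repZ_proj hb, quo_repZ, zero_add]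

omit [NeZero N] in
/-- `𝒬ᵀ` written with the block index `quo`. [folklore] -/
theorem contourSumAdj_eq (φ : Form1 D ℝ) (κ : Fin D) (x : AffineAveraging.Site D) :
    contourSumAdj N φ κ x = ∑ s ∈ Finset.range N, φ κ (quo N (x - (s : ℤ) • unitVec κ)) := rfl

/-- **ADJOINTNESS OF THE STRAIGHT-CONTOUR BLOCK SUM** on `ℤ^D`: `⟨A, 𝒬ᵀφ⟩ = ∑'_y ∑_κ φ_κ(y) (𝒬A)_κ(y)` for summable `A`
and bounded `φ`. [folklore] -/
theorem lip1_contourSumAdj {A φ : Form1 D ℝ} {M : ℝ} (hA : ∀ κ, Summable (A κ)) (hφ : ∀ κ y, |φ κ y| ≤ M) :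
    lip1 A (contourSumAdj N φ) = ∑' y, ∑ κ, φ κ y * contourSum N A κ y := by
  -- summability of the pieces
  have hw : ∀ κ (s : ℕ), Summable (fun x => A κ x * φ κ (quo N (x - (s : ℤ) • unitVec κ))) := fun κ s =>
    summable_mul_of_bdd' (hA κ) (fun x => hφ κ _)
  have hw' : ∀ κ (s : ℕ), Summable (fun x => A κ (x + (s : ℤ) • unitVec κ) * φ κ (quo N x)) := fun κ s =>
    summable_mul_of_bdd' (summable_shift (hA κ) _) (fun x => hφ κ _)
  have hb : ∀ κ (s : ℕ), Summable (fun y => φ κ y * ∑ b ∈ box D N, A κ ((N : ℤ) • y + toSite b + (s : ℤ) • unitVec κ)) :=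
    fun κ s => by
      have h := summable_mul_of_bdd (hφ κ) (summable_blocks (N := N) (summable_shift (hA κ) ((s : ℤ) • unitVec κ)))
      exact h
  unfold lip1
  calc ∑' x, ∑ κ, A κ x * contourSumAdj N φ κ x
      = ∑' x, ∑ κ, ∑ s ∈ Finset.range N, A κ x * φ κ (quo N (x - (s : ℤ) • unitVec κ)) := by
        refine tsum_congr (fun x => Finset.sum_congr rfl (fun κ _ => ?_))
        rw [contourSumAdj_eq, Finset.mul_sum]
    _ = ∑ κ, ∑ s ∈ Finset.range N, ∑' x, A κ x * φ κ (quo N (x - (s : ℤ) • unitVec κ)) := by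
        rw [Summable.tsum_finsetSum (fun κ _ => summable_sum fun s _ => hw κ s)]
        exact Finset.sum_congr rfl fun κ _ => Summable.tsum_finsetSum (fun s _ => hw κ s)
    _ = ∑ κ, ∑ s ∈ Finset.range N, ∑' x, A κ (x + (s : ℤ) • unitVec κ) * φ κ (quo N x) := by
        refine Finset.sum_congr rfl (fun κ _ => Finset.sum_congr rfl (fun s _ => ?_))
        rw [← tsum_shift (fun x => A κ x * φ κ (quo N (x - (s : ℤ) • unitVec κ))) ((s : ℤ) • unitVec κ)]
        simp only [add_sub_cancel_right]
    _ = ∑ κ, ∑ s ∈ Finset.range N, ∑' y, φ κ y * ∑ b ∈ box D N, A κ ((N : ℤ) • y + toSite b + (s : ℤ) • unitVec κ) := by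
        refine Finset.sum_congr rfl (fun κ _ => Finset.sum_congr rfl (fun s _ => ?_))
        rw [tsum_blocks (N := N) (hw' κ s)]
        refine tsum_congr (fun y => ?_)
        rw [Finset.mul_sum]
        refine Finset.sum_congr rfl (fun b hb => ?_)
        rw [quo_zsmul_add_toSite (N := N) y hb, mul_comm]
    _ = ∑' y, ∑ κ, ∑ s ∈ Finset.range N, φ κ y * ∑ b ∈ box D N, A κ ((N : ℤ) • y + toSite b + (s : ℤ) • unitVec κ) := by
        rw [Summable.tsum_finsetSum (fun κ _ => summable_sum fun s _ => hb κ s)]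
        exact Finset.sum_congr rfl fun κ _ => (Summable.tsum_finsetSum (fun s _ => hb κ s)).symm
    _ = ∑' y, ∑ κ, φ κ y * contourSum N A κ y := by
        refine tsum_congr (fun y => Finset.sum_congr rfl (fun κ _ => ?_))
        rw [← Finset.mul_sum, contourSum, Finset.sum_comm]

end Blocks

/-! ## §5 The energy identity for `Γ_N`: symmetry and positivity -/

section Energy

variable {d : ℕ} [NeZero N]

/-- The column `Γ_b`, `b = (l, x')`, as a fine 1-form. [folklore] -/
def Gcol (l : Fin (d + 1)) (x' : AffineAveraging.Site (d + 1)) : Form1 (d + 1) ℝ :=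
  fun κ x => Gam (N := N) κ x l x'

/-- Its gauge multiplier `M_b` as a fine 0-form. [folklore] -/
def Mcol (l : Fin (d + 1)) (x' : AffineAveraging.Site (d + 1)) : Form0 (d + 1) ℝ :=
  fun z => GamM (N := N) z l x'

/-- Its constraint multiplier `Φ_b` as a coarse 1-form. [folklore] -/
def Φcol (l : Fin (d + 1)) (x' : AffineAveraging.Site (d + 1)) : Form1 (d + 1) ℝ :=
  fun κ q => GamΦ (N := N) κ q l x'

/-- The unit force `δ_b`. [folklore] -/
def δcol (l : Fin (d + 1)) (x' : AffineAveraging.Site (d + 1)) : Form1 (d + 1) ℝ :=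
  fun μ x => if μ = l ∧ x = x' then 1 else 0

/-- (EL) for the column, as an identity of 1-forms. [folklore] -/
theorem curvAdj_curv_Gcol (l : Fin (d + 1)) (x' : AffineAveraging.Site (d + 1)) :
    curvAdj (curv (Gcol (N := N) l x'))
      = contourSumAdj N (Φcol (N := N) l x') + dz (codiff₁ (dz (Mcol (N := N) l x'))) + δcol l x' := by
  funext μ x
  exact Gam_EL (N := N) l x' μ x

/-- Uniform bound and summability of the columns (from `decay_Gam`, at fixed `N`). [folklore] -/
theorem Gcol_bdd_summable : ∃ C : ℝ, 0 ≤ C ∧ (∀ (l : Fin (d + 1)) (x' : AffineAveraging.Site (d + 1)) κ x,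
    |Gcol (N := N) l x' κ x| ≤ C) ∧ ∀ (l : Fin (d + 1)) (x' : AffineAveraging.Site (d + 1)) κ,
      Summable (Gcol (N := N) l x' κ) := by
  obtain ⟨δ, C, hδ, hC, h⟩ := decay_Gam (N := N) (d := d)
  refine ⟨C, hC, fun l x' κ x => abs_le_of_exp_bound hδ hC x' (fun z => h κ z l x') x,
    fun l x' κ => summable_of_exp_bound hδ x' (fun z => h κ z l x')⟩

/-- Uniform bound and summability of the gauge multipliers (from `decay_wΓμ`). [folklore] -/
theorem Mcol_bdd_summable : ∃ C : ℝ, 0 ≤ C ∧ (∀ (l : Fin (d + 1)) (x' : AffineAveraging.Site (d + 1)) z,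
    |Mcol (N := N) l x' z| ≤ C) ∧ ∀ (l : Fin (d + 1)) (x' : AffineAveraging.Site (d + 1)),
      Summable (Mcol (N := N) l x') := by
  obtain ⟨δ, C, hδ, hC, h⟩ := decay_wΓμ (N := N) (d := d)
  refine ⟨C, hC, fun l x' z => ?_, fun l x' => ?_⟩
  · have hz := h l (Torus.proj N x') (z - (N : ℤ) • quo N x')
    have he : Real.exp (-δ * l1 (z - (N : ℤ) • quo N x')) ≤ 1 := by
      rw [Real.exp_le_one_iff]
      nlinarith [l1_nonneg (z - (N : ℤ) • quo N x')]
    have : |Mcol (N := N) l x' z| ≤ C * Real.exp (-δ * l1 (z - (N : ℤ) • quo N x')) := hz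
    nlinarith
  · exact summable_shift_sub (summable_of_decay510 hδ (h l (Torus.proj N x'))) ((N : ℤ) • quo N x')

/-- Uniform bound of the constraint multipliers (from `decay_wΓφ`). [folklore] -/
theorem Φcol_bdd : ∃ C : ℝ, 0 ≤ C ∧ ∀ (l : Fin (d + 1)) (x' : AffineAveraging.Site (d + 1)) κ q,
    |Φcol (N := N) l x' κ q| ≤ C := by
  obtain ⟨δ, C, hδ, hC, h⟩ := decay_wΓφ (N := N) (d := d)
  refine ⟨C, hC, fun l x' κ q => ?_⟩
  have hz := h l (Torus.proj N x') κ (q - quo N x')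
  have he : Real.exp (-δ * l1 (q - quo N x')) ≤ 1 := by
    rw [Real.exp_le_one_iff]
    nlinarith [l1_nonneg (q - quo N x')]
  have : |Φcol (N := N) l x' κ q| ≤ C * Real.exp (-δ * l1 (q - quo N x')) := hz
  nlinarith

/-- The `𝒬ᵀΦ_b` term pairs to zero with any column: (Q) `𝒬Γ_{b'} = 0` and §4 adjointness. [folklore] -/
theorem lip1_Gcol_contourSumAdj (l l' : Fin (d + 1)) (x' x'' : AffineAveraging.Site (d + 1)) :
    lip1 (Gcol (N := N) l' x'') (contourSumAdj N (Φcol (N := N) l x')) = 0 := by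
  obtain ⟨C, _, hbdd, hsum⟩ := Gcol_bdd_summable (N := N) (d := d)
  obtain ⟨CΦ, _, hΦ⟩ := Φcol_bdd (N := N) (d := d)
  rw [lip1_contourSumAdj (N := N) (hsum l' x'') (hΦ l x')]
  refine (tsum_congr (fun y => ?_)).trans tsum_zero
  refine Finset.sum_eq_zero (fun κ _ => ?_)
  have hQ : contourSum N (Gcol (N := N) l' x'') κ y = 0 := Gam_Q (N := N) l' x'' κ y
  rw [hQ, mul_zero]

/-- The gauge term `dδd M_b` pairs to zero with any column: three adjointness steps (§3), then (G) block-constancy of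
`δdδΓ_{b'}` against (M) zero block sums of `M_b` (§4). [folklore] -/
theorem lip1_Gcol_gauge (l l' : Fin (d + 1)) (x' x'' : AffineAveraging.Site (d + 1)) :
    lip1 (Gcol (N := N) l' x'') (dz (codiff₁ (dz (Mcol (N := N) l x')))) = 0 := by
  obtain ⟨C, _, hbdd, hsum⟩ := Gcol_bdd_summable (N := N) (d := d)
  obtain ⟨CM, _, hMb, hMs⟩ := Mcol_bdd_summable (N := N) (d := d)
  have h1 : ∀ x, |codiff₁ (Gcol (N := N) l' x'') x| ≤ (d + 1 : ℕ) * (2 * C) := fun x =>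
    abs_codiff₁_le (hbdd l' x'') x
  have h2 : ∀ κ x, |dz (codiff₁ (Gcol (N := N) l' x'')) κ x| ≤ 2 * ((d + 1 : ℕ) * (2 * C)) := fun κ x =>
    abs_dz_le h1 κ x
  have h3 : ∀ x, |codiff₁ (dz (codiff₁ (Gcol (N := N) l' x''))) x| ≤ (d + 1 : ℕ) * (2 * (2 * ((d + 1 : ℕ) * (2 * C)))) :=
    fun x => abs_codiff₁_le h2 x
  have hdzM : ∀ κ, Summable (dz (Mcol (N := N) l x') κ) := fun κ => summable_dz (hMs l x') κ
  rw [lip1_dz (hbdd l' x'') (summable_codiff₁ hdzM), lip0_codiff₁ h1 hdzM, lip1_dz h2 (hMs l x')]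
  exact tsum_mul_eq_zero_of_blockConst (N := N) h3 (Gam_G (N := N) l' x'') (hMs l x') (GamM_M (N := N) l x')

/-- The force term pairs to the kernel entry: `⟨Γ_{b'}, δ_b⟩ = Γ_{b'}(b)`. [folklore] -/
theorem lip1_Gcol_δcol (l l' : Fin (d + 1)) (x' x'' : AffineAveraging.Site (d + 1)) :
    lip1 (Gcol (N := N) l' x'') (δcol l x') = Gam (N := N) l x' l' x'' := by
  unfold lip1
  have e : ∀ x, ∑ μ, Gcol (N := N) l' x'' μ x * δcol l x' μ x = if x = x' then Gam (N := N) l x l' x'' else 0 := by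
    intro x
    by_cases hx : x = x'
    · subst hx
      simp [δcol, Gcol]
    · simp [δcol, Gcol, hx]
  rw [tsum_congr e, tsum_eq_single x' (fun x hx => if_neg hx), if_pos rfl]

/-- **THE ENERGY IDENTITY.**  `Γ((l, x'), (l', x'')) = ⟨curv Γ_{(l', x'')}, curv Γ_{(l, x')}⟩_{ℤ^{d+1}}`. [folklore] -/
theorem Gam_eq_lip2 (l l' : Fin (d + 1)) (x' x'' : AffineAveraging.Site (d + 1)) :
    Gam (N := N) l x' l' x'' = lip2 (curv (Gcol (N := N) l' x'')) (curv (Gcol (N := N) l x')) := by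
  obtain ⟨C, _, hbdd, hsum⟩ := Gcol_bdd_summable (N := N) (d := d)
  obtain ⟨CM, _, hMb, hMs⟩ := Mcol_bdd_summable (N := N) (d := d)
  obtain ⟨CΦ, _, hΦ⟩ := Φcol_bdd (N := N) (d := d)
  rw [← lip1_curvAdj (hbdd l' x'') (fun κ l₂ => summable_curv (hsum l x') κ l₂), curvAdj_curv_Gcol]
  -- summability of the three pairings
  have sT1 : ∀ μ, Summable (fun x => Gcol (N := N) l' x'' μ x * contourSumAdj N (Φcol (N := N) l x') μ x) := fun μ =>
    summable_mul_of_bdd' (hsum l' x'' μ) (fun x => abs_contourSumAdj_le (hΦ l x') μ x)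
  have hT2b : ∀ μ x, |dz (codiff₁ (dz (Mcol (N := N) l x'))) μ x| ≤ 2 * ((d + 1 : ℕ) * (2 * (2 * CM))) := fun μ x =>
    abs_dz_le (fun z => abs_codiff₁_le (fun κ w => abs_dz_le (hMb l x') κ w) z) μ x
  have sT2 : ∀ μ, Summable (fun x => Gcol (N := N) l' x'' μ x * dz (codiff₁ (dz (Mcol (N := N) l x'))) μ x) := fun μ =>
    summable_mul_of_bdd' (hsum l' x'' μ) (hT2b μ)
  have sδ : ∀ μ, Summable (fun x => Gcol (N := N) l' x'' μ x * δcol l x' μ x) := fun μ =>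
    summable_mul_of_bdd' (M := 1) (hsum l' x'' μ) (fun x => by
      unfold δcol
      split_ifs <;> simp)
  have s12 : ∀ μ, Summable (fun x => Gcol (N := N) l' x'' μ x
      * (contourSumAdj N (Φcol (N := N) l x') + dz (codiff₁ (dz (Mcol (N := N) l x')))) μ x) := fun μ => by
    have h := (sT1 μ).add (sT2 μ)
    simpa only [Pi.add_apply, mul_add] using h
  rw [lip1_add s12 sδ, lip1_add sT1 sT2, lip1_Gcol_contourSumAdj, lip1_Gcol_gauge, lip1_Gcol_δcol, zero_add, zero_add]

/-- **SYMMETRY OF THE FLUCTUATION COVARIANCE KERNEL**: `Γ(b, b') = Γ(b', b)`. [folklore] -/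
theorem Gam_symm (l l' : Fin (d + 1)) (x' x'' : AffineAveraging.Site (d + 1)) :
    Gam (N := N) l x' l' x'' = Gam (N := N) l' x'' l x' := by
  rw [Gam_eq_lip2, Gam_eq_lip2, lip2_comm]

/-- The diagonal is an energy: `Γ(b, b) = ∑'_x ∑_{κl} ((curv Γ_b)_{κl}(x))²`. [folklore] -/
theorem Gam_self_eq (l : Fin (d + 1)) (x' : AffineAveraging.Site (d + 1)) :
    Gam (N := N) l x' l x' = ∑' x, ∑ κ, ∑ l₂, (curv (Gcol (N := N) l x') κ l₂ x) ^ 2 := by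
  rw [Gam_eq_lip2]
  unfold lip2
  refine tsum_congr (fun x => Finset.sum_congr rfl (fun κ _ => Finset.sum_congr rfl (fun l₂ _ => ?_)))
  ring

/-- **POSITIVITY OF THE DIAGONAL**: `0 ≤ Γ(b, b)`. [folklore] -/
theorem Gam_self_nonneg (l : Fin (d + 1)) (x' : AffineAveraging.Site (d + 1)) : 0 ≤ Gam (N := N) l x' l x' := by
  rw [Gam_self_eq]
  exact tsum_nonneg fun x => Finset.sum_nonneg fun κ _ => Finset.sum_nonneg fun l₂ _ => sq_nonneg _

/-- A finite linear combination of columns `W = ∑_{b ∈ S} a_b Γ_b`. [folklore] -/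
def GcolSum (S : Finset (Fin (d + 1) × AffineAveraging.Site (d + 1)))
    (a : Fin (d + 1) × AffineAveraging.Site (d + 1) → ℝ) : Form1 (d + 1) ℝ :=
  fun κ x => ∑ b ∈ S, a b * Gcol (N := N) b.1 b.2 κ x

/-- `curv` is linear on finite combinations of columns. [folklore] -/
theorem curv_GcolSum (S : Finset (Fin (d + 1) × AffineAveraging.Site (d + 1)))
    (a : Fin (d + 1) × AffineAveraging.Site (d + 1) → ℝ) :
    curv (GcolSum (N := N) S a) = fun κ l x => ∑ b ∈ S, a b * curv (Gcol (N := N) b.1 b.2) κ l x := by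
  funext κ l x
  simp only [curv, GcolSum]
  rw [← Finset.sum_add_distrib, ← Finset.sum_sub_distrib, ← Finset.sum_sub_distrib]
  refine Finset.sum_congr rfl fun b _ => ?_
  ring

/-- **POSITIVE-SEMIDEFINITENESS OF THE FLUCTUATION COVARIANCE KERNEL**: every finite quadratic form in `Γ` is the energy
`‖curv W‖²` of the corresponding combination of columns, hence `≥ 0`. [folklore] -/
theorem Gam_psd (S : Finset (Fin (d + 1) × AffineAveraging.Site (d + 1)))
    (a : Fin (d + 1) × AffineAveraging.Site (d + 1) → ℝ) :
    0 ≤ ∑ b ∈ S, ∑ b' ∈ S, a b * a b' * Gam (N := N) b.1 b.2 b'.1 b'.2 := by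
  obtain ⟨C, hC, hbdd, hsum⟩ := Gcol_bdd_summable (N := N) (d := d)
  have hWb : ∀ κ x, |GcolSum (N := N) S a κ x| ≤ ∑ b ∈ S, |a b| * C := fun κ x => by
    simp only [GcolSum]
    calc |∑ b ∈ S, a b * Gcol (N := N) b.1 b.2 κ x| ≤ ∑ b ∈ S, |a b * Gcol (N := N) b.1 b.2 κ x| :=
          Finset.abs_sum_le_sum_abs _ _
      _ ≤ ∑ b ∈ S, |a b| * C := Finset.sum_le_sum fun b _ => by
          rw [abs_mul]
          exact mul_le_mul_of_nonneg_left (hbdd _ _ κ x) (abs_nonneg _)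
  have hFF : ∀ b b' : Fin (d + 1) × AffineAveraging.Site (d + 1), ∀ κ l₂,
      Summable (fun x => curv (Gcol (N := N) b.1 b.2) κ l₂ x * curv (Gcol (N := N) b'.1 b'.2) κ l₂ x) :=
    fun b b' κ l₂ => summable_mul_of_bdd (abs_curv_le (hbdd b.1 b.2) κ l₂) (summable_curv (hsum b'.1 b'.2) κ l₂)
  have hFW : ∀ b : Fin (d + 1) × AffineAveraging.Site (d + 1), ∀ κ l₂,
      Summable (fun x => curv (Gcol (N := N) b.1 b.2) κ l₂ x * curv (GcolSum (N := N) S a) κ l₂ x) :=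
    fun b κ l₂ => summable_mul_of_bdd' (summable_curv (hsum b.1 b.2) κ l₂) (abs_curv_le hWb κ l₂)
  have e1 : ∀ b ∈ S, ∑ b' ∈ S, a b * a b' * Gam (N := N) b.1 b.2 b'.1 b'.2
      = a b * lip2 (curv (Gcol (N := N) b.1 b.2)) (curv (GcolSum (N := N) S a)) := by
    intro b _
    rw [curv_GcolSum, lip2_sum_right S a _ _ (fun b' _ κ l₂ => hFF b b' κ l₂), Finset.mul_sum]
    refine Finset.sum_congr rfl fun b' _ => ?_
    rw [Gam_eq_lip2, lip2_comm]
    ring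
  rw [Finset.sum_congr rfl e1, ← lip2_sum_left S a _ _ (fun b _ κ l₂ => hFW b κ l₂), ← curv_GcolSum]
  exact tsum_nonneg fun x => Finset.sum_nonneg fun κ _ => Finset.sum_nonneg fun l₂ _ => mul_self_nonneg _

end Energy

end

end Literature.MathematicalPhysics.QuantumFieldTheory.Balaban1983to89.Beta.KKTFluctuationEnergy
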